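import Summits.AtomisticToContinuum.Crystallization.Theorems.PalmUnimodularRigidityLayeredLawsSelectHcpZeroStressSymmetry

/-!
# Crux `LayeredLawsSelectHcp` (stmt-AtomisticToContinuum-9226), line `mtp-prestress-split-ergodic-frame`:
# the partial forces of the two sublattices on the root vanish (stub `sublatticeForce_vanishes`)

Step (β) of the FRAME-FREE first-order mechanism of the registered rigidity core `stub_hcpTubeRigidity`
(checked skeleton `Cruxes/LayeredLawsSelectHcp/Lines/mtp_prestress_split_ergodic_frame.lean`).  Expanding
the mean root energy in the squared bond lengths `s_v = ‖y_v‖²` (`V_LJ(r) = W(r²)`, `W′ = ljSqDeriv`), the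
partial FORCE exerted on the root `A`-site `hcpSite a h 0 = 0` by a sublattice is
`Σ_v χ(k_v) W′(‖y_v‖²) y_v` with `y_v = hcpSite a h v`, `k_v = v.1` the layer index and `χ` the indicator
of the odd layers (the `B`-sites; the letters of `alternatingHagg` alternate with the parity of the layer)
or of the even layers (the `A`-sites; the root term is `0` since `y_0 = 0`).  Both vanish for ALL
`a, h ≠ 0`, componentwise, by the `D_3h` site symmetry of hcp — no minimality, no numerics:

* the series `v ↦ χ(k_v) W′(‖y_v‖²) (y_v)_l` is summable for every weight `|χ| ≤ 1`
  (`summable_hcpForceTerm`: `|W′(s) (y_v)_l| ≤ |W′(s)| s / √(min (a², h²)) ≤ ½ (s⁻³ + s⁻⁶)/√min`, and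
  the landed `summable_hcpRadicand_inv_pow_three` / `_six`);
* re-indexing by an involution of `ℤ³` that preserves the site norms and the weight (`hcpForce_reindex`,
  `Equiv.tsum_eq`), with the three landed index mirrors `hcpMirrorX_spec` (`y₀ ↦ −y₀`),
  `hcpMirrorZ_spec` (`k ↦ −k`, `y₂ ↦ −y₂`; the weight is kept as soon as `χ` is even) and
  `hcpMirrorD_spec` (`(y₀, y₁) ↦ (y₀/2 + (√3/2) y₁, (√3/2) y₀ − y₁/2)`): component `0` vanishes by `X`,
  component `2` by `Z`, and component `1` by `D` combined with component `0`
  (`F₁ = (√3/2) F₀ − F₁/2`).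

`sublatticeForce_vanishes` (REGISTERED sub-goal) is the specialisation to the two parity indicators.
All `[folklore]`; nothing here closes an item.
-/

noncomputable section

namespace Summit.AtomisticToContinuum.Crystallization.Theorems.PalmUnimodularRigidity.LayeredLawsSelectHcp

open Literature.MathematicalPhysics.StatisticalMechanics

/-! ## Summability of the weighted force series -/

/-- Pointwise bound `|χ(k) W′(‖y_v‖²) (y_v)_l| ≤ (√min(a²,h²))⁻¹ · ½ ([v≠0] s⁻³ + [v≠0] s⁻⁶)` for a weight
`|χ| ≤ 1` (`s = a² Q v + k² h² = ‖y_v‖²`; the root term vanishes since `y_0 = 0`). [folklore] -/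
theorem norm_hcpForceTerm_le {a h : ℝ} (ha : a ≠ 0) (hh : h ≠ 0) {χ : ℤ → ℝ}
    (hχ1 : ∀ k, |χ k| ≤ 1) (l : Fin 3) (v : ℤ × ℤ × ℤ) :
    ‖χ v.1 * (ljSqDeriv (‖hcpSite a h v‖ ^ 2) * hcpSite a h v l)‖ ≤
      (√(min (a ^ 2) (h ^ 2)))⁻¹ * ((1 / 2) *
        ((if v = 0 then (0 : ℝ) else ((a ^ 2 * hcpQ v + (v.1 : ℝ) ^ 2 * h ^ 2)⁻¹) ^ 3) +
         (if v = 0 then (0 : ℝ) else ((a ^ 2 * hcpQ v + (v.1 : ℝ) ^ 2 * h ^ 2)⁻¹) ^ 6))) := by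
  split_ifs with hv
  · subst hv
    simp [hcpSite_zero]
  · have hp := hcpRadicand_pos ha hh hv
    have hm : 0 < min (a ^ 2) (h ^ 2) := lt_min (by positivity) (by positivity)
    have hsm : 0 < √(min (a ^ 2) (h ^ 2)) := Real.sqrt_pos.2 hm
    have hy : √(min (a ^ 2) (h ^ 2)) ≤ ‖hcpSite a h v‖ :=
      (Real.sqrt_le_left (norm_nonneg _)).2
        ((min_sq_le_hcpRadicand a h hv).trans (hcpSite_norm_sq a h v).symm.le)
    have hy' : ‖hcpSite a h v‖ ≤ (√(min (a ^ 2) (h ^ 2)))⁻¹ * ‖hcpSite a h v‖ ^ 2 := by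
      rw [le_inv_mul_iff₀ hsm, sq ‖hcpSite a h v‖]
      exact mul_le_mul_of_nonneg_right hy (norm_nonneg _)
    have hl : |hcpSite a h v l| ≤ ‖hcpSite a h v‖ := by
      simpa [Real.norm_eq_abs] using PiLp.norm_apply_le (hcpSite a h v) l
    rw [Real.norm_eq_abs, abs_mul, abs_mul]
    calc |χ v.1| * (|ljSqDeriv (‖hcpSite a h v‖ ^ 2)| * |hcpSite a h v l|)
        ≤ 1 * (|ljSqDeriv (‖hcpSite a h v‖ ^ 2)| * ‖hcpSite a h v‖) :=
          mul_le_mul (hχ1 _) (mul_le_mul_of_nonneg_left hl (abs_nonneg _)) (by positivity)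
            zero_le_one
      _ ≤ |ljSqDeriv (‖hcpSite a h v‖ ^ 2)| *
            ((√(min (a ^ 2) (h ^ 2)))⁻¹ * ‖hcpSite a h v‖ ^ 2) := by
          rw [one_mul]
          exact mul_le_mul_of_nonneg_left hy' (abs_nonneg _)
      _ = (√(min (a ^ 2) (h ^ 2)))⁻¹ * (|ljSqDeriv (a ^ 2 * hcpQ v + (v.1 : ℝ) ^ 2 * h ^ 2)| *
            (a ^ 2 * hcpQ v + (v.1 : ℝ) ^ 2 * h ^ 2)) := by
          rw [mul_left_comm, hcpSite_norm_sq]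
      _ ≤ (√(min (a ^ 2) (h ^ 2)))⁻¹ * ((1 / 2) *
            (((a ^ 2 * hcpQ v + (v.1 : ℝ) ^ 2 * h ^ 2)⁻¹) ^ 3 +
              ((a ^ 2 * hcpQ v + (v.1 : ℝ) ^ 2 * h ^ 2)⁻¹) ^ 6)) :=
          mul_le_mul_of_nonneg_left (abs_ljSqDeriv_mul_le hp) (inv_nonneg.2 hsm.le)

/-- **The weighted force series `v ↦ χ(k_v) W′(‖y_v‖²) (y_v)_l` is summable** for every weight
`|χ| ≤ 1` (`a, h ≠ 0`). [folklore] -/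
theorem summable_hcpForceTerm {a h : ℝ} (ha : a ≠ 0) (hh : h ≠ 0) {χ : ℤ → ℝ}
    (hχ1 : ∀ k, |χ k| ≤ 1) (l : Fin 3) :
    Summable fun v : ℤ × ℤ × ℤ => χ v.1 * (ljSqDeriv (‖hcpSite a h v‖ ^ 2) * hcpSite a h v l) :=
  Summable.of_norm_bounded
    ((((summable_hcpRadicand_inv_pow_three ha hh).add
      (summable_hcpRadicand_inv_pow_six ha hh)).mul_left (1 / 2)).mul_left
        (√(min (a ^ 2) (h ^ 2)))⁻¹)
    (norm_hcpForceTerm_le ha hh hχ1 l)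

/-! ## Re-indexing by an index symmetry -/

/-- **Re-indexing the weighted force series** by an involution `σ` of `ℤ³` preserving the weight and the
site norms: `Σ' χ W′(‖y_v‖²) (y_v)_l = Σ' χ W′(‖y_v‖²) (y_{σ v})_l`. [folklore] -/
theorem hcpForce_reindex (a h : ℝ) (χ : ℤ → ℝ) {σ : ℤ × ℤ × ℤ → ℤ × ℤ × ℤ}
    (hσ : Function.Involutive σ) (hχσ : ∀ v, χ (σ v).1 = χ v.1)
    (hn : ∀ v, ‖hcpSite a h (σ v)‖ ^ 2 = ‖hcpSite a h v‖ ^ 2) (l : Fin 3) :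
    ∑' v : ℤ × ℤ × ℤ, χ v.1 * (ljSqDeriv (‖hcpSite a h v‖ ^ 2) * hcpSite a h v l) =
      ∑' v : ℤ × ℤ × ℤ, χ v.1 * (ljSqDeriv (‖hcpSite a h v‖ ^ 2) * hcpSite a h (σ v) l) := by
  rw [← Equiv.tsum_eq (hσ.toPerm σ)]
  exact tsum_congr fun v => by simp only [Function.Involutive.coe_toPerm, hχσ, hn]

/-- If moreover `(y_{σ v})_l = −(y_v)_l` for all `v`, the `l`-th weighted force component vanishes (the
series equals its own negative). [folklore] -/
theorem hcpForce_eq_zero_of_mirror (a h : ℝ) (χ : ℤ → ℝ) {σ : ℤ × ℤ × ℤ → ℤ × ℤ × ℤ}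
    (hσ : Function.Involutive σ) (hχσ : ∀ v, χ (σ v).1 = χ v.1)
    (hn : ∀ v, ‖hcpSite a h (σ v)‖ ^ 2 = ‖hcpSite a h v‖ ^ 2) {l : Fin 3}
    (hl : ∀ v, hcpSite a h (σ v) l = -hcpSite a h v l) :
    ∑' v : ℤ × ℤ × ℤ, χ v.1 * (ljSqDeriv (‖hcpSite a h v‖ ^ 2) * hcpSite a h v l) = 0 := by
  have key := hcpForce_reindex a h χ hσ hχσ hn l
  have hneg : (∑' v : ℤ × ℤ × ℤ,
      χ v.1 * (ljSqDeriv (‖hcpSite a h v‖ ^ 2) * hcpSite a h (σ v) l)) =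
      -∑' v : ℤ × ℤ × ℤ, χ v.1 * (ljSqDeriv (‖hcpSite a h v‖ ^ 2) * hcpSite a h v l) := by
    rw [← tsum_neg]
    exact tsum_congr fun v => by rw [hl]; ring
  linarith

/-! ## The three components -/

/-- **Component `1` from component `0`** by the `π/6` mirror `(k,i,j) ↦ (k,j,i)`:
`F₁ = (√3/2) F₀ − F₁/2`, so `F₀ = 0 ⇒ F₁ = 0` (uses the summability, `|χ| ≤ 1`, `a, h ≠ 0`). [folklore] -/
theorem hcpForce_one_eq_zero {a h : ℝ} (ha : a ≠ 0) (hh : h ≠ 0) {χ : ℤ → ℝ}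
    (hχ1 : ∀ k, |χ k| ≤ 1)
    (h0 : ∑' v : ℤ × ℤ × ℤ, χ v.1 * (ljSqDeriv (‖hcpSite a h v‖ ^ 2) * hcpSite a h v 0) = 0) :
    ∑' v : ℤ × ℤ × ℤ, χ v.1 * (ljSqDeriv (‖hcpSite a h v‖ ^ 2) * hcpSite a h v 1) = 0 := by
  obtain ⟨hDi, -, hDc, hDn⟩ := hcpMirrorD_spec a h
  have key := hcpForce_reindex a h χ hDi (fun _ => rfl) hDn 1
  have hterm : ∀ v : ℤ × ℤ × ℤ,
      χ v.1 * (ljSqDeriv (‖hcpSite a h v‖ ^ 2) * hcpSite a h (v.1, v.2.2, v.2.1) 1) =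
      √3 / 2 * (χ v.1 * (ljSqDeriv (‖hcpSite a h v‖ ^ 2) * hcpSite a h v 0)) -
        1 / 2 * (χ v.1 * (ljSqDeriv (‖hcpSite a h v‖ ^ 2) * hcpSite a h v 1)) := fun v => by
    rw [(hDc v).2.1]; ring
  rw [tsum_congr hterm, ((summable_hcpForceTerm ha hh hχ1 0).mul_left _).tsum_sub
    ((summable_hcpForceTerm ha hh hχ1 1).mul_left _), tsum_mul_left, tsum_mul_left, h0] at key
  linarith

/-- **All three weighted force components vanish** for an even weight `χ(−k) = χ(k)` with `|χ| ≤ 1`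
(`a, h ≠ 0`): component `0` by the mirror `x ↦ −x`, component `2` by the mirror `z ↦ −z` (which keeps the
weight since `χ` is even), component `1` by `hcpForce_one_eq_zero`. [folklore] -/
theorem hcpForce_eq_zero {a h : ℝ} (ha : a ≠ 0) (hh : h ≠ 0) {χ : ℤ → ℝ}
    (hχe : ∀ k, χ (-k) = χ k) (hχ1 : ∀ k, |χ k| ≤ 1) (l : Fin 3) :
    ∑' v : ℤ × ℤ × ℤ, χ v.1 * (ljSqDeriv (‖hcpSite a h v‖ ^ 2) * hcpSite a h v l) = 0 := by
  obtain ⟨hXi, -, hXc, hXn⟩ := hcpMirrorX_spec a h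
  obtain ⟨hZi, -, hZc, hZn⟩ := hcpMirrorZ_spec a h
  have h0 : ∑' v : ℤ × ℤ × ℤ,
      χ v.1 * (ljSqDeriv (‖hcpSite a h v‖ ^ 2) * hcpSite a h v 0) = 0 :=
    hcpForce_eq_zero_of_mirror a h χ hXi (fun _ => rfl) hXn fun v => (hXc v).1
  have h1 : ∑' v : ℤ × ℤ × ℤ,
      χ v.1 * (ljSqDeriv (‖hcpSite a h v‖ ^ 2) * hcpSite a h v 1) = 0 :=
    hcpForce_one_eq_zero ha hh hχ1 h0
  have h2 : ∑' v : ℤ × ℤ × ℤ,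
      χ v.1 * (ljSqDeriv (‖hcpSite a h v‖ ^ 2) * hcpSite a h v 2) = 0 :=
    hcpForce_eq_zero_of_mirror a h χ hZi (fun v => hχe v.1) hZn fun v => (hZc v).2.2
  fin_cases l
  exacts [h0, h1, h2]

/-! ## The registered statement -/

/-- **Registered sub-goal `sublatticeForce_vanishes` of crux stmt-AtomisticToContinuum-9226 (step (β) of the
frame-free mechanism of `stub_hcpTubeRigidity`): the partial forces exerted on the root `A`-site by the
`B`-sublattice (odd layers) and by the `A`-sublattice (even layers) of `hcp(a, h)` vanish separately**,
componentwise, for all `a, h ≠ 0` — the `D_3h` site symmetry of hcp; no minimality is used. [folklore] -/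
theorem sublatticeForce_vanishes : ∀ a h : ℝ, a ≠ 0 → h ≠ 0 → ∀ l : Fin 3,
    (∑' v : ℤ × ℤ × ℤ, (if Even v.1 then (0 : ℝ) else
      ljSqDeriv (‖hcpSite a h v‖ ^ 2) * hcpSite a h v l)) = 0 ∧
    (∑' v : ℤ × ℤ × ℤ, (if Even v.1 then
      ljSqDeriv (‖hcpSite a h v‖ ^ 2) * hcpSite a h v l else (0 : ℝ))) = 0 := by
  intro a h ha hh l
  have hB := hcpForce_eq_zero ha hh (χ := fun k => if Even k then (0 : ℝ) else 1)
    (fun k => by simp only [even_neg]) (fun k => by by_cases hk : Even k <;> simp [hk]) l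
  have hA := hcpForce_eq_zero ha hh (χ := fun k => if Even k then (1 : ℝ) else 0)
    (fun k => by simp only [even_neg]) (fun k => by by_cases hk : Even k <;> simp [hk]) l
  refine ⟨(tsum_congr fun v => ?_).trans hB, (tsum_congr fun v => ?_).trans hA⟩
  · by_cases hv : Even v.1 <;> simp [hv]
  · by_cases hv : Even v.1 <;> simp [hv]

end Summit.AtomisticToContinuum.Crystallization.Theorems.PalmUnimodularRigidity.LayeredLawsSelectHcp

end
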